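import Mathlib
import Literature.Analysis.FluidPDE.VectorCalculus
import Summits.NavierStokesRegularity.NavierStokesRegularity.Theorems.UnthreadedDoorFluxStarvedDipoleAmplitudeIdentityWindow
import HarnessLib

/-!
# Route `UnthreadedDoor`, crux `PoloidalLiouville` (stmt-NavierStokesRegularity-1222), wall W1 — crux idea
# «flux-starved-dipoles» (ns-idea-15 g12/g13, `Cruxes/PoloidalLiouville/FluxStarvedDipoleSketch.lean`):
# the amplitude identity `∂ₜa = ℓ` on ALL of `{a > 0}` (K1′, §Proof step 5′ — solid points included)

`amplitudeIdentity_window` (p838686) gives `⟪A″ + (2/r)A′ − (2/r²)A − ∂ₜA, A⟫(t,r) = 0` at NON-SOLID radii (tangency on a shell +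
pole identity).  At SOLID radii (`r(‖A‖)′ = ‖A‖`) no tangency is available, but none is needed: the latitude-independent
identity `(a − r a′)·M = −r²(ℓ − ∂ₜa)` (`latitude_identity_gen`, p838588) has a vanishing left factor there, so `ℓ = ∂ₜa`
directly (the card: "at solid points the identity gives `ℓ = 0` directly").  THIS FILE records this and assembles the identity on
all of `{A ≠ 0}`:

* `amplitudeIdentity_solid_gen` — general reduced scalar `Ψ = ΔT + ⟪W, ·−x₀⟫ + D'` on `S_r`, `u ∈ C¹` divergence-free, law
  off the centre, `A(r) ≠ 0`, `r(‖A‖)′(r) = ‖A(r)‖` ⇒ `⟪A″ + (2/r)A′ − (2/r²)A, A⟫(r) + r⟪W, A(r)⟫ = 0`;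
* `window_reducedScalar` — the time-`t` slice of (E1) is the steady law with reduced scalar `⟪u,∇T⟫ − Ψ`, `Ψ = ΔT − ∂ₜT`
  differentiable off the centre and `Ψ = ΔT − ⟪∂ₜA(t,r)/r, y⟫ − ∂ₜR(t,r)` on every `S_r(x₀)` (packaged from p838637/p838686);
* `amplitudeIdentity_window_all` — on an open time set, (E1) for the turning-axis dipole with slices `u(t) ∈ C¹` divergence-free
  and `A, R` jointly `C³`: for EVERY `t ∈ S`, `r > 0` with `A(t,r) ≠ 0`, `⟪A″ + (2/r)A′ − (2/r²)A − ∂ₜA, A⟫(t,r) = 0`, i.e.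
  `a ∂ₜa = a ℓ` on `{a > 0}` — the first sentence of the card's K1′ proof, in the kernel.

What K1′ (`DipoleNeverAncient`) still needs: the passage to `q = a/r` as an ancient subsolution of the radial heat equation of
`ℝ⁵` across the kinks of `a = ‖A‖` and the parabolic mean-value endgame [XL].  HONEST LABEL: dipole (`l = 1`) stratum of the
LINEAR kinematic shadow of W1 (critic V28: information-grade, W1 movement 0); `PoloidalLiouville` (1222), its wall
`stub_scalarLiouville` and the summit stay OPEN; NO Navier–Stokes regularity statement is proved.
`--supports stmt-NavierStokesRegularity-1222` (helper).  [folklore]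
-/

noncomputable section

-- the summit and its single sub-problem share the name (CONVENTIONS §1)
set_option linter.dupNamespace false

open Set Filter Topology InnerProductSpace
open scoped RealInnerProductSpace Laplacian
open Literature.Analysis.FluidPDE
open Summit.NavierStokesRegularity.NavierStokesRegularity.Theorems.PoloidalLiouville.HorizonTower (E3)

namespace Summit.NavierStokesRegularity.NavierStokesRegularity.Theorems.PoloidalLiouville.FluxStarvedDipole

/-! ### Solid radii -/

/-- **AMPLITUDE IDENTITY AT A SOLID RADIUS, general reduced scalar.**  Law `∇(⟪u,∇T⟫ − Ψ) × (x−x₀) = ∇⟪u, x−x₀⟫ × ∇T` off the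
centre with `Ψ = ΔT + ⟪W, ·−x₀⟫ + D'` on `S_r(x₀)` (`Ψ` differentiable off the centre), `u ∈ C¹` divergence-free,
`A, R ∈ C³(0,∞)`, `A(r) ≠ 0`.  If `r` is SOLID (`r(‖A‖)′(r) = ‖A(r)‖`) then `⟪A″ + (2/r)A′ − (2/r²)A, A⟫(r) + r⟪W, A(r)⟫ = 0`:
the latitude-independent identity `(a − r⟪A′,n⟫)·M = −r³⟪Cv, n⟫` on the equator has a vanishing left factor. [folklore] -/
theorem amplitudeIdentity_solid_gen (u : E3 → E3) (x₀ : E3) (A : ℝ → E3) (R : ℝ → ℝ)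
    (hu : ContDiff ℝ 1 u) (hdiv : Literature.Analysis.FluidPDE.VectorCalculus.IsDivFree u)
    (hA : ContDiffOn ℝ 3 A (Set.Ioi 0)) (hR : ContDiffOn ℝ 3 R (Set.Ioi 0)) {Ψ : E3 → ℝ}
    (hlaw : ∀ x ∈ ({x₀}ᶜ : Set E3),
      cross (gradient (fun z => ⟪u z, gradient (fun x => ⟪A ‖x - x₀‖, x - x₀⟫ / ‖x - x₀‖ + R ‖x - x₀‖) z⟫
          - Ψ z) x) (x - x₀)
        = cross (gradient (fun z => ⟪u z, z - x₀⟫) x)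
            (gradient (fun x => ⟪A ‖x - x₀‖, x - x₀⟫ / ‖x - x₀‖ + R ‖x - x₀‖) x))
    {r : ℝ} (hr : 0 < r) (hAr : A r ≠ 0) (hsolid : r * deriv (fun s => ‖A s‖) r = ‖A r‖)
    (hΨd : ∀ x : E3, x ≠ x₀ → DifferentiableAt ℝ Ψ x) {W : E3} {D' : ℝ}
    (hΨ : ∀ y : E3, ‖y‖ = r →
      Ψ (x₀ + y) = Δ (fun x => ⟪A ‖x - x₀‖, x - x₀⟫ / ‖x - x₀‖ + R ‖x - x₀‖) (x₀ + y) + ⟪W, y⟫ + D') :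
    ⟪iteratedDeriv 2 A r + (2 / r) • deriv A r - (2 / r ^ 2) • A r, A r⟫ + r * ⟪W, A r⟫ = 0 := by
  set T : E3 → ℝ := fun x => ⟪A ‖x - x₀‖, x - x₀⟫ / ‖x - x₀‖ + R ‖x - x₀‖ with hTdef
  have hT : ∀ z, T z = ⟪A ‖z - x₀‖, z - x₀⟫ / ‖z - x₀‖ + R ‖z - x₀‖ := fun z => rfl
  -- the unit axis and a radial frame
  have hAn0 : ‖A r‖ ≠ 0 := norm_ne_zero_iff.mpr hAr
  obtain ⟨n, hn_def⟩ : ∃ n : E3, n = ‖A r‖⁻¹ • A r := ⟨_, rfl⟩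
  have hn1 : ‖n‖ = 1 := by rw [hn_def, norm_smul, norm_inv, norm_norm, inv_mul_cancel₀ hAn0]
  have hAn : A r = ‖A r‖ • n := by rw [hn_def, smul_smul, mul_inv_cancel₀ hAn0, one_smul]
  obtain ⟨b, hb0, -, hb1, hb2⟩ := NetFlux.exists_orthonormalBasis_radial hn1
  obtain ⟨C, D, hC, hΔ⟩ := dipole_laplacian_sphere hT hA hR b hr
  obtain ⟨Cv, hCv⟩ : ∃ Cv : E3, Cv = (∑ i, C i • b i) + W := ⟨_, rfl⟩
  have hQ : ∀ y : E3, ‖y‖ = r → Ψ (x₀ + y) = ⟪Cv, y⟫ + (D + D') := by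
    intro y hy
    rw [hΨ y hy, hΔ y hy, hCv, inner_add_left, sum_inner]
    simp only [real_inner_smul_left, mul_comm]
    ring
  have hCn : ⟪Cv, n⟫ = C 0 + ⟪W, n⟫ := by
    have hb00 : ⟪b 0, n⟫ = 1 := by rw [hb0, real_inner_self_eq_norm_sq, hn1, one_pow]
    rw [hCv, inner_add_left, sum_inner, Fin.sum_univ_three, real_inner_smul_left, real_inner_smul_left,
      real_inner_smul_left, hb00, hb1, hb2]
    ring
  -- the equator of the axis: a unit vector `e ⊥ n`, colatitude `π/2`
  obtain ⟨e, he, hen⟩ := NetFlux.exists_unit_orth n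
  have hne : ⟪n, e⟫ = 0 := by rw [real_inner_comm]; exact hen
  have hθ : Real.sin (Real.pi / 2) ≠ 0 := by rw [Real.sin_pi_div_two]; exact one_ne_zero
  have hlat := latitude_identity_gen u x₀ A R hu hdiv hA hR hlaw hr hAr hn1 hAn he hne hΨd hQ hθ
  -- the solid factor vanishes
  have hA1 : DifferentiableAt ℝ A r := (hA.differentiableOn (by norm_num)).differentiableAt (Ioi_mem_nhds hr)
  have ha' : deriv (fun s => ‖A s‖) r = ⟪deriv A r, n⟫ := by rw [deriv_norm_eq_inner_unit hA1 hAr, hn_def]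
  have hfac : ‖A r‖ - r * ⟪deriv A r, n⟫ = 0 := by rw [← ha', hsolid, sub_self]
  rw [hfac, zero_mul] at hlat
  have hCn0 : ⟪Cv, n⟫ = 0 := by
    have h : r ^ 3 * ⟪Cv, n⟫ = 0 := by linarith
    rcases mul_eq_zero.mp h with h | h
    · exact absurd h (pow_ne_zero 3 hr.ne')
    · exact h
  -- unpack `C 0 = ⟪A″ + (2/r)A′ − (2/r²)A, n⟫ / r`
  have hval := hC 0
  rw [hb0] at hval
  have hX : ⟪iteratedDeriv 2 A r + (2 / r) • deriv A r - (2 / r ^ 2) • A r, n⟫ + r * ⟪W, n⟫ = 0 := by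
    rw [inner_sub_left, inner_add_left, real_inner_smul_left, real_inner_smul_left]
    have h : r * (C 0 + ⟪W, n⟫) = 0 := by rw [← hCn, hCn0, mul_zero]
    rw [hval] at h
    have hrr : r * r⁻¹ = 1 := mul_inv_cancel₀ hr.ne'
    linear_combination h
      - (⟪iteratedDeriv 2 A r, n⟫ + 2 / r * ⟪deriv A r, n⟫ - 2 / r ^ 2 * ⟪A r, n⟫) * hrr
  rw [hn_def, inner_smul_right, inner_smul_right] at hX
  have h' : ‖A r‖⁻¹ * (⟪iteratedDeriv 2 A r + (2 / r) • deriv A r - (2 / r ^ 2) • A r, A r⟫ + r * ⟪W, A r⟫) = 0 := by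
    linear_combination hX
  rcases mul_eq_zero.mp h' with h | h
  · exact absurd h (inv_ne_zero hAn0)
  · exact h

/-! ### The time slice of (E1) as a steady law with a general reduced scalar -/

/-- **The reduced scalar of a time slice.**  On an open time set `S` with `A, R` jointly `C³` on `S × (0,∞)` and (E1) on
`S × {x₀}ᶜ` for the turning-axis dipole potential (unfolded sketch shapes): at `t ∈ S` the slice satisfies the steady law with
reduced scalar `⟪u,∇T⟫ − Ψ` for some `Ψ` (namely `ΔT − ∂ₜT`) which is differentiable off the centre and equals
`ΔT(x₀ + y) + ⟪−∂ₜA(t,r)/r, y⟫ − ∂ₜR(t,r)` on every sphere `S_r(x₀)`, `∂ₜA(t,r) = D(uncurry A)(t,r)[(1,0)]`. [folklore] -/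
theorem window_reducedScalar (S : Set ℝ) (u : ℝ → E3 → E3) (x₀ : E3) (A : ℝ → ℝ → E3) (R : ℝ → ℝ → ℝ)
    (hS : IsOpen S) (hA : ContDiffOn ℝ 3 (Function.uncurry A) (S ×ˢ Set.Ioi 0))
    (hR : ContDiffOn ℝ 3 (Function.uncurry R) (S ×ˢ Set.Ioi 0))
    (hlaw : ∀ t ∈ S, ∀ x, x ≠ x₀ →
      cross (gradient (fun z => deriv (fun s => ⟪A s ‖z - x₀‖, z - x₀⟫ / ‖z - x₀‖ + R s ‖z - x₀‖) t
          + ⟪u t z, gradient (fun x => ⟪A t ‖x - x₀‖, x - x₀⟫ / ‖x - x₀‖ + R t ‖x - x₀‖) z⟫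
          - Δ (fun x => ⟪A t ‖x - x₀‖, x - x₀⟫ / ‖x - x₀‖ + R t ‖x - x₀‖) z) x) (x - x₀)
        = cross (gradient (fun z => ⟪u t z, z - x₀⟫) x)
            (gradient (fun x => ⟪A t ‖x - x₀‖, x - x₀⟫ / ‖x - x₀‖ + R t ‖x - x₀‖) x))
    {t : ℝ} (ht : t ∈ S) :
    ∃ Ψ : E3 → ℝ, (∀ x : E3, x ≠ x₀ → DifferentiableAt ℝ Ψ x) ∧
      (∀ r > 0, ∀ y : E3, ‖y‖ = r →
        Ψ (x₀ + y) = Δ (fun x => ⟪A t ‖x - x₀‖, x - x₀⟫ / ‖x - x₀‖ + R t ‖x - x₀‖) (x₀ + y)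
          + ⟪-(r⁻¹ • fderiv ℝ (Function.uncurry A) (t, r) ((1 : ℝ), (0 : ℝ))), y⟫
          + (-(fderiv ℝ (Function.uncurry R) (t, r) ((1 : ℝ), (0 : ℝ))))) ∧
      (∀ x ∈ ({x₀}ᶜ : Set E3),
        cross (gradient (fun z => ⟪u t z, gradient (fun x => ⟪A t ‖x - x₀‖, x - x₀⟫ / ‖x - x₀‖ + R t ‖x - x₀‖) z⟫
            - Ψ z) x) (x - x₀)
          = cross (gradient (fun z => ⟪u t z, z - x₀⟫) x)
              (gradient (fun x => ⟪A t ‖x - x₀‖, x - x₀⟫ / ‖x - x₀‖ + R t ‖x - x₀‖) x)) := by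
  have hAt : ContDiffOn ℝ 3 (A t) (Ioi 0) := slice_contDiffOn_right hA ht
  have hRt : ContDiffOn ℝ 3 (R t) (Ioi 0) := slice_contDiffOn_right hR ht
  set T : E3 → ℝ := fun x => ⟪A t ‖x - x₀‖, x - x₀⟫ / ‖x - x₀‖ + R t ‖x - x₀‖ with hTdef
  have hT : ∀ z, T z = ⟪A t ‖z - x₀‖, z - x₀⟫ / ‖z - x₀‖ + R t ‖z - x₀‖ := fun z => rfl
  obtain ⟨A₁, hA₁⟩ : ∃ A₁ : ℝ → E3, A₁ = fun ρ => fderiv ℝ (Function.uncurry A) (t, ρ) ((1 : ℝ), (0 : ℝ)) := ⟨_, rfl⟩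
  obtain ⟨R₁, hR₁⟩ : ∃ R₁ : ℝ → ℝ, R₁ = fun ρ => fderiv ℝ (Function.uncurry R) (t, ρ) ((1 : ℝ), (0 : ℝ)) := ⟨_, rfl⟩
  have hA₁c : ContDiffOn ℝ 2 A₁ (Ioi 0) := by rw [hA₁]; exact slice_fderiv_contDiffOn hA hS ht
  have hR₁c : ContDiffOn ℝ 2 R₁ (Ioi 0) := by rw [hR₁]; exact slice_fderiv_contDiffOn hR hS ht
  obtain ⟨Td, hTd⟩ : ∃ Td : E3 → ℝ, Td = fun z => ⟪A₁ ‖z - x₀‖, z - x₀⟫ / ‖z - x₀‖ + R₁ ‖z - x₀‖ := ⟨_, rfl⟩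
  have hTd' : ∀ z, Td z = ⟪A₁ ‖z - x₀‖, z - x₀⟫ / ‖z - x₀‖ + R₁ ‖z - x₀‖ := fun z => by rw [hTd]
  have hdot : ∀ z : E3, z ≠ x₀ →
      deriv (fun s => ⟪A s ‖z - x₀‖, z - x₀⟫ / ‖z - x₀‖ + R s ‖z - x₀‖) t = Td z := by
    intro z hz
    have hρ : 0 < ‖z - x₀‖ := norm_pos_iff.mpr (sub_ne_zero.mpr hz)
    have h1 : HasDerivAt (fun s => A s ‖z - x₀‖) (A₁ ‖z - x₀‖) t := by
      rw [hA₁]; exact slice_hasDerivAt_left hA hS ht hρ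
    have h2 : HasDerivAt (fun s => R s ‖z - x₀‖) (R₁ ‖z - x₀‖) t := by
      rw [hR₁]; exact slice_hasDerivAt_left hR hS ht hρ
    have h : HasDerivAt (fun s => ⟪A s ‖z - x₀‖, z - x₀⟫ / ‖z - x₀‖ + R s ‖z - x₀‖)
        ((⟪A t ‖z - x₀‖, (0 : E3)⟫ + ⟪A₁ ‖z - x₀‖, z - x₀⟫) / ‖z - x₀‖ + R₁ ‖z - x₀‖) t :=
      ((h1.inner ℝ (hasDerivAt_const t (z - x₀))).div_const ‖z - x₀‖).add h2
    rw [h.deriv, hTd', inner_zero_right, zero_add]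
  refine ⟨fun z => Δ T z - Td z, ?_, ?_, ?_⟩
  · intro z hz
    have h3 := dipole_contDiffAt hT hAt hRt hz
    have h4 : ContDiffAt ℝ 2 Td z := dipole_contDiffAt_of hTd' hA₁c hR₁c hz
    exact (dipole_differentiableAt_laplacian h3).sub (h4.differentiableAt (by norm_num))
  · intro r hr y hy
    rw [hTd, hA₁, hR₁]
    simp only [add_sub_cancel_left, hy]
    rw [inner_neg_left, real_inner_smul_left, div_eq_inv_mul]
    ring
  · intro x hx'
    have hxne : x ≠ x₀ := hx'
    have h := hlaw t ht x hxne
    have hev : (fun z => deriv (fun s => ⟪A s ‖z - x₀‖, z - x₀⟫ / ‖z - x₀‖ + R s ‖z - x₀‖) t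
        + ⟪u t z, gradient T z⟫ - Δ T z) =ᶠ[𝓝 x] (fun z => ⟪u t z, gradient T z⟫ - (Δ T z - Td z)) := by
      filter_upwards [isOpen_compl_singleton.mem_nhds hxne] with z hz
      rw [hdot z hz]
      ring
    rw [← hev.gradient_eq]
    exact h

/-! ### The amplitude identity on all of `{A ≠ 0}` -/

/-- **TIME-DEPENDENT AMPLITUDE IDENTITY ON `{a > 0}`** (K1′ `DipoleNeverAncient`, card §Proof step 5′: "flux starvation gives
`∂ₜa = ℓ` on `{a > 0}`").  On an open time set `S`: slices `u(t) ∈ C¹` divergence-free, `A, R` jointly `C³` on `S × (0,∞)`, the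
law (E1) on `S × {x₀}ᶜ` for the turning-axis dipole potential (sketch `KinematicLawOn S u (dipolePotentialT x₀ A R) x₀`,
unfolded).  Then for EVERY `t ∈ S` and `r > 0` with `A(t,r) ≠ 0`:
`⟪A″ + (2/r)A′ − (2/r²)A − ∂ₜA, A⟫(t,r) = 0` (`∂ₜA(t,r) = D(uncurry A)(t,r)[(1,0)]`), i.e. `a ∂ₜa = a ℓ`.
Non-solid radii: `amplitudeIdentity_window` (p838686); solid radii: `amplitudeIdentity_solid_gen`. [folklore] -/
theorem amplitudeIdentity_window_all :
    ∀ (S : Set ℝ) (u : ℝ → E3 → E3) (x₀ : E3) (A : ℝ → ℝ → E3) (R : ℝ → ℝ → ℝ), IsOpen S →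
      (∀ t ∈ S, ContDiff ℝ 1 (u t)) → (∀ t ∈ S, Literature.Analysis.FluidPDE.VectorCalculus.IsDivFree (u t)) →
      ContDiffOn ℝ 3 (Function.uncurry A) (S ×ˢ Set.Ioi 0) → ContDiffOn ℝ 3 (Function.uncurry R) (S ×ˢ Set.Ioi 0) →
      (∀ t ∈ S, ∀ x, x ≠ x₀ →
        cross (gradient (fun z => deriv (fun s => ⟪A s ‖z - x₀‖, z - x₀⟫ / ‖z - x₀‖ + R s ‖z - x₀‖) t
            + ⟪u t z, gradient (fun x => ⟪A t ‖x - x₀‖, x - x₀⟫ / ‖x - x₀‖ + R t ‖x - x₀‖) z⟫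
            - Δ (fun x => ⟪A t ‖x - x₀‖, x - x₀⟫ / ‖x - x₀‖ + R t ‖x - x₀‖) z) x) (x - x₀)
          = cross (gradient (fun z => ⟪u t z, z - x₀⟫) x)
              (gradient (fun x => ⟪A t ‖x - x₀‖, x - x₀⟫ / ‖x - x₀‖ + R t ‖x - x₀‖) x)) →
      ∀ t ∈ S, ∀ r > 0, A t r ≠ 0 →
        ⟪iteratedDeriv 2 (A t) r + (2 / r) • deriv (A t) r - (2 / r ^ 2) • A t r
            - fderiv ℝ (Function.uncurry A) (t, r) ((1 : ℝ), (0 : ℝ)), A t r⟫ = 0 := by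
  intro S u x₀ A R hS hu hdiv hA hR hlaw t ht r hr hAr
  by_cases hsol : r * deriv (fun s => ‖A t s‖) r = ‖A t r‖
  swap
  · exact amplitudeIdentity_window S u x₀ A R hS hu hdiv hA hR hlaw t ht r hr hAr hsol
  have hAt : ContDiffOn ℝ 3 (A t) (Ioi 0) := slice_contDiffOn_right hA ht
  have hRt : ContDiffOn ℝ 3 (R t) (Ioi 0) := slice_contDiffOn_right hR ht
  obtain ⟨Ψ, hΨd, hΨs, hlaw'⟩ := window_reducedScalar S u x₀ A R hS hA hR hlaw ht
  have hP := amplitudeIdentity_solid_gen (u t) x₀ (A t) (R t) (hu t ht) (hdiv t ht) hAt hRt hlaw' hr hAr hsol hΨd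
    (hΨs r hr)
  rw [inner_neg_left, real_inner_smul_left] at hP
  rw [inner_sub_left]
  have hrr : r * r⁻¹ = 1 := mul_inv_cancel₀ hr.ne'
  linear_combination hP + ⟪fderiv ℝ (Function.uncurry A) (t, r) ((1 : ℝ), (0 : ℝ)), A t r⟫ * hrr

end Summit.NavierStokesRegularity.NavierStokesRegularity.Theorems.PoloidalLiouville.FluxStarvedDipole

end
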